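import Literature.NumberTheory.Automorphic.MultipliableLGL2
import Literature.NumberTheory.Automorphic.SatakeParameterRankTwoBound
import Literature.NumberTheory.Automorphic.SummableNormSqTraceSatakePowTorus
import Literature.NumberTheory.Automorphic.JacquetShalikaEulerProductsProofs
import HarnessLib

/-!
# Jacquet–Shalika's (5.3.3)–(5.3.4) for `GL₂`, off an arbitrary set of places

Topic `NumberTheory/Automorphic`; namespace `Literature.NumberTheory.Automorphic`. Proof file
(theorems only: no definition, no named fact). The named fact
`summable_normSq_trace_satakePow` of `AutomorphicLFunctionProofs` (Jacquet–Shalika, *On Euler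
products and the classification of automorphic representations I*, Amer. J. Math. **103** (1981),
Thm. (5.3), proof, (5.3.3)–(5.3.4), p. 556: for a unitary cuspidal `π` of `GL_n(𝔸_K)` the
Dirichlet series `∑_{v ∉ S} ∑_{k ≥ 1} |tr A_v^k|² / (k q_v^{kσ})` converges for `σ > 1`) is stated
in the tree for an **arbitrary** set `S` off which `Π` has Satake parameters. By
`summable_normSq_trace_satakePow_iff_largeFinset_and_sqrt` (`SummableNormSqTraceSatakePowTorus`)
it is the conjunction of

* (J) `summable_normSq_trace_largeFinset` — the printed statement, `S ⊇ S₀(Π)` finite and large —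
  equivalently the boundedness `JacquetShalika1981_schurSelfSum_prod_bounded` of the partial
  products of the unramified Rankin–Selberg torus sums `T_v(q_v^{-σ})`
  (`JacquetShalikaSchurSelfSum`); and
* (5.1.3) `norm_satakeParameter_le_sqrt` — `|μ_{j,v}| ≤ q_v^{1/2}` at **every** unramified place.

For `n = 2` both are now theorems of the tree: (J) is `jacquetShalika1981_schurSelfSum_prod_bounded_two`
(`MultipliableLGL2`, the mean-square route: Whittaker coefficient of a smoothed cusp form,
Shintani's formula, dyadic mean-square bounds) and (5.1.3) is `norm_satakeParameter_le_sqrt_two`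
(`SatakeParameterRankTwoBound`: unitarity of the central character and of the Hecke operators).
Hence:

* `summable_normSq_trace_largeFinset_two` — (J) for `GL₂`;
* `summable_normSq_trace_satakePow_two`, `summable_normSq_trace_satakePow_of_le_two` — **the named
  fact `summable_normSq_trace_satakePow` holds unconditionally in rank `n ≤ 2`**, for every cuspidal
  `Π`, every set `S` and every Satake family of `Π` off `S` (`n ≤ 1`:
  `summable_normSq_trace_satakePow_of_le_one` of `SatakeParameterUnitBound`);
* `JacquetShalika1981_continuation_partialPairL_conj_two` — Lemma (5.2) of loc. cit. for `GL₂`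
  (`L_S(s, π × π̄)` continues holomorphically to `re s > 1`), through
  `JacquetShalika1981_continuation_partialPairL_conj_of_schurSelfSum_prod_bounded`.

The general-`n` discharge `summable_normSq_trace_satakePow_holds` waits for the `GL_n` real-point
Rankin–Selberg machine (`RankinSelbergTorusIntegral`, `RankinSelbergSiegelFiniteness`, the
Whittaker tower) run at every unramified place; see the module docstring of
`SummableNormSqTraceSatakePowTorus`.

## References

* H. Jacquet, J. A. Shalika, *On Euler products and the classification of automorphic
  representations I*, Amer. J. Math. 103 (1981), 499–558 [JacquetShalikaAJM1981]: (5.1.3) p. 554;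
  Lemma (5.2) p. 554; Thm. (5.3) p. 555, proof (5.3.3)–(5.3.4) p. 556.
-/

noncomputable section

open MeasureTheory NumberField IsDedekindDomain

namespace Literature.NumberTheory.Automorphic

variable {K : Type} [Field K] [NumberField K]

section Two

variable {μ : Measure (AdelicGroupData.gl 2 K).automorphicQuotient}
  [(AdelicGroupData.gl 2 K).IsAutomorphicMeasure μ]

/-- **(J) for `GL₂`**: for every cuspidal `Π` of `GL₂(𝔸_K)` there is a finite `S₀` such that
`∑_{v ∉ S} ∑_k |tr A_v^k|²/(k q_v^{kσ}) < ∞` for `σ > 1` and every finite `S ⊇ S₀` off which `Π` has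
Satake parameters (Jacquet–Shalika (1981), (5.3.3)–(5.3.4) as printed), from the bounded torus-sum
products of `MultipliableLGL2`. [cite: JacquetShalikaAJM1981, Thm. (5.3), proof, (5.3.3)–(5.3.4)] -/
theorem summable_normSq_trace_largeFinset_two :
    summable_normSq_trace_largeFinset (n := 2) (K := K) (μ := μ) :=
  summable_normSq_trace_largeFinset_of_schurSelfSum_prod_bounded
    jacquetShalika1981_schurSelfSum_prod_bounded_two

/-- **Jacquet–Shalika's (5.3.3)–(5.3.4) for `GL₂`, off an arbitrary `S`**: the named fact
`summable_normSq_trace_satakePow` holds for `n = 2` — (J) (`summable_normSq_trace_largeFinset_two`)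
and (5.1.3) (`norm_satakeParameter_le_sqrt_two`) glued by
`summable_normSq_trace_satakePow_of_largeFinset_of_sqrt`.
[cite: JacquetShalikaAJM1981, Thm. (5.3), proof, (5.3.3)–(5.3.4), (5.1.3)] -/
theorem summable_normSq_trace_satakePow_two :
    summable_normSq_trace_satakePow (n := 2) (K := K) (μ := μ) :=
  summable_normSq_trace_satakePow_of_largeFinset_of_sqrt norm_satakeParameter_le_sqrt_two
    summable_normSq_trace_largeFinset_two

/-- **Lemma (5.2) of Jacquet–Shalika (1981) for `GL₂`**: for every cuspidal `Π` of `GL₂(𝔸_K)`,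
`L_S(s, π × π̄)` (finite large `S`) continues holomorphically to `re s > 1`, in the tree's form
`JacquetShalika1981_continuation_partialPairL_conj` (`JacquetShalikaEulerProducts`).
[cite: JacquetShalikaAJM1981, Lemma (5.2) p. 554] -/
theorem JacquetShalika1981_continuation_partialPairL_conj_two :
    JacquetShalika1981_continuation_partialPairL_conj (n := 2) (K := K) (μ := μ) :=
  JacquetShalika1981_continuation_partialPairL_conj_of_schurSelfSum_prod_bounded
    jacquetShalika1981_schurSelfSum_prod_bounded_two

end Two

section LeTwo

variable {n : ℕ} {μ : Measure (AdelicGroupData.gl n K).automorphicQuotient}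
  [(AdelicGroupData.gl n K).IsAutomorphicMeasure μ]

/-- **`summable_normSq_trace_satakePow` holds unconditionally in rank `n ≤ 2`** (`n ≤ 1`:
`summable_normSq_trace_satakePow_of_le_one`; `n = 2`: `summable_normSq_trace_satakePow_two`).
[cite: JacquetShalikaAJM1981, Thm. (5.3), proof, (5.3.3)–(5.3.4)] -/
theorem summable_normSq_trace_satakePow_of_le_two (hn : n ≤ 2) :
    summable_normSq_trace_satakePow (n := n) (K := K) (μ := μ) := by
  rcases Nat.lt_or_ge n 2 with h | h
  · exact summable_normSq_trace_satakePow_of_le_one (by omega)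
  · obtain rfl : n = 2 := le_antisymm hn h
    exact summable_normSq_trace_satakePow_two

/-- (J) (`summable_normSq_trace_largeFinset`) holds unconditionally in rank `n ≤ 2`. [folklore] -/
theorem summable_normSq_trace_largeFinset_of_le_two (hn : n ≤ 2) :
    summable_normSq_trace_largeFinset (n := n) (K := K) (μ := μ) :=
  summable_normSq_trace_largeFinset_of_summable (summable_normSq_trace_satakePow_of_le_two hn)

/-- Lemma (5.2) (`JacquetShalika1981_continuation_partialPairL_conj`) holds unconditionally in rank
`n ≤ 2`. [cite: JacquetShalikaAJM1981, Lemma (5.2) p. 554] -/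
theorem JacquetShalika1981_continuation_partialPairL_conj_of_le_two (hn : n ≤ 2) :
    JacquetShalika1981_continuation_partialPairL_conj (n := n) (K := K) (μ := μ) :=
  JacquetShalika1981_continuation_partialPairL_conj_of_largeFinset
    (summable_normSq_trace_largeFinset_of_le_two hn)

end LeTwo

end Literature.NumberTheory.Automorphic
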